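import Summits.QuantumFields.YangMills.Theorems.BalabanLadderNTReferencePackageExplicit
import Summits.QuantumFields.YangMills.Theses.BalabanLadder
import HarnessLib

/-!
# Crux `NT` (stmt-QuantumFields-19353): reference-state transfer, XIV — the crux idea's `RefPackage` VERBATIM
# (cold wall, margins `8 h h' + w` and `6 Σ h·w + 8 h³ + w₃`) gives `BalabanLadder.NT` BY NAME

Helper file (`--supports stmt-QuantumFields-19353`) of the fleet lead prover of crux `NT` (unit `ym-spine-19353-p1`,
g4).  The crux idea `Cruxes/NT/Ideas/reference-state-transfer.md` (cruxidea-19353-1 g3, `Sketch.lean` §D4) typed its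
transfer target `RefPackage` with the COLD WALL `fun _ => 1` as the reference exterior of the cube of radius `⌈ρ/aβ⌉₊`,
the two-point margin `8 h_{θv} h_v + w_{θv,v}` and the FACTORISED three-point margin
`6 (h_f w_{gh} + h_g w_{fh} + h_h w_{fg}) + 8 h_f h_g h_h + w₃` (no nonnegativity of the constants assumed), and proved
`nt_of_refPackage` modulo a sorried composition.  Files IV–VI/X landed the composition with sharper hypotheses
(arbitrary exterior, margins `2hh' + w` and the per-triple sum, constants `≥ 0`).  This file closes the loop VERBATIM:

* `sum₃_margin_factorise` — the per-triple margin factorises: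
  `Σ_{x,y,z} A_x B_y C_z (p (W₁(y,z) + W₂(x,z) + W₃(x,y) + q) + V) = p ((ΣA)(ΣΣ B C W₁) + (ΣB)(ΣΣ A C W₂) + (ΣC)(ΣΣ A B W₃)
  + q (ΣA)(ΣB)(ΣC)) + ΣΣΣ A B C V`;
* `nonneg_of_osc₁/₂/₃` — the oscillation ceilings force `0 ≤ C₁, C₂, C₃` (instantiate at one site of the unit cube);
* `nt_of_refPackage_card` — the card's `(∀ G simple, ∃ (r,a), units ∧ RefPackage)` with every definition of the Sketch
  unfolded (`refR`, `refE`, `coldWall`, `RQ2`, `RQ3`, `E1/E2/E3oscWith`, `hErr`, `wErr`, `w3Err`, `RefFloor2`, `RefFloor3`)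
  ⇒ `Summit.QuantumFields.YangMills.Theses.BalabanLadder.NT`.

Refs: card `Cruxes/NT/Ideas/reference-state-transfer.md` §First lemma (D4), `Sketch.lean` rev 3 e88baf025cde322f §D.
-/

set_option autoImplicit false

noncomputable section

open scoped SchwartzMap
open MeasureTheory Filter Topology
open Literature.MathematicalPhysics.QuantumFieldTheory Literature.MathematicalPhysics.QuantumLattice
open Literature.Probability.LatticeModels
open Summit.QuantumFields.YangMills.Cruxes.OSLegsFromFemtoAndGap.DlrCollarTransfer

namespace Summit.QuantumFields.YangMills.Cruxes.NT.Reference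

/-! ## §1 Factorisation of the per-triple margin -/

/-- **The per-triple transfer margin factorises** into products of one-point and two-point lattice sums. [folklore] -/
theorem sum₃_margin_factorise {ι : Type*} (s : Finset ι) (A B C : ι → ℝ) (W₁ W₂ W₃ : ι → ι → ℝ)
    (V : ι → ι → ι → ℝ) (p q : ℝ) :
    ∑ x ∈ s, ∑ y ∈ s, ∑ z ∈ s, A x * B y * C z * (p * (W₁ y z + W₂ x z + W₃ x y + q) + V x y z) =
      p * ((∑ x ∈ s, A x) * (∑ y ∈ s, ∑ z ∈ s, B y * C z * W₁ y z) +
           (∑ y ∈ s, B y) * (∑ x ∈ s, ∑ z ∈ s, A x * C z * W₂ x z) +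
           (∑ z ∈ s, C z) * (∑ x ∈ s, ∑ y ∈ s, A x * B y * W₃ x y) +
           q * ((∑ x ∈ s, A x) * (∑ y ∈ s, B y) * (∑ z ∈ s, C z))) +
      ∑ x ∈ s, ∑ y ∈ s, ∑ z ∈ s, A x * B y * C z * V x y z := by
  have e1 : (∑ x ∈ s, A x) * (∑ y ∈ s, ∑ z ∈ s, B y * C z * W₁ y z) =
      ∑ x ∈ s, ∑ y ∈ s, ∑ z ∈ s, A x * B y * C z * W₁ y z := by
    rw [Finset.sum_mul_sum]
    refine Finset.sum_congr rfl fun x _ => Finset.sum_congr rfl fun y _ => ?_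
    rw [Finset.mul_sum]
    exact Finset.sum_congr rfl fun z _ => by ring
  have e2 : (∑ y ∈ s, B y) * (∑ x ∈ s, ∑ z ∈ s, A x * C z * W₂ x z) =
      ∑ x ∈ s, ∑ y ∈ s, ∑ z ∈ s, A x * B y * C z * W₂ x z := by
    rw [Finset.sum_mul_sum, Finset.sum_comm]
    refine Finset.sum_congr rfl fun x _ => Finset.sum_congr rfl fun y _ => ?_
    rw [Finset.mul_sum]
    exact Finset.sum_congr rfl fun z _ => by ring
  have e3 : (∑ z ∈ s, C z) * (∑ x ∈ s, ∑ y ∈ s, A x * B y * W₃ x y) =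
      ∑ x ∈ s, ∑ y ∈ s, ∑ z ∈ s, A x * B y * C z * W₃ x y := by
    rw [Finset.mul_sum]
    refine Finset.sum_congr rfl fun x _ => ?_
    rw [Finset.mul_sum]
    refine Finset.sum_congr rfl fun y _ => ?_
    rw [Finset.sum_mul]
    exact Finset.sum_congr rfl fun z _ => by ring
  have e4 : (∑ x ∈ s, A x) * (∑ y ∈ s, B y) * (∑ z ∈ s, C z) =
      ∑ x ∈ s, ∑ y ∈ s, ∑ z ∈ s, A x * B y * C z := by
    rw [mul_assoc, Finset.sum_mul_sum s s B C, Finset.sum_mul]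
    refine Finset.sum_congr rfl fun x _ => ?_
    rw [Finset.mul_sum]
    refine Finset.sum_congr rfl fun y _ => ?_
    rw [Finset.mul_sum]
    exact Finset.sum_congr rfl fun z _ => by ring
  have h : ∀ x y z, A x * B y * C z * (p * (W₁ y z + W₂ x z + W₃ x y + q) + V x y z) =
      p * (A x * B y * C z * W₁ y z) + p * (A x * B y * C z * W₂ x z) + p * (A x * B y * C z * W₃ x y) +
        p * q * (A x * B y * C z) + A x * B y * C z * V x y z := by
    intros; ring
  simp_rw [h]
  simp only [Finset.sum_add_distrib, ← Finset.mul_sum]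
  have e5 : ∑ x ∈ s, ∑ y ∈ s, A x * B y * ∑ z ∈ s, C z = ∑ x ∈ s, ∑ y ∈ s, ∑ z ∈ s, A x * B y * C z :=
    Finset.sum_congr rfl fun x _ => Finset.sum_congr rfl fun y _ => by rw [Finset.mul_sum]
  rw [e1, e2, e3, e4, e5]
  ring

/-- Pulling two constants out of a weighted double sum: `ΣΣ B_y C_z (k (c / D)) = k (c ΣΣ B_y C_z / D)`. [folklore] -/
theorem sum₂_pull_consts {ι : Type*} (s : Finset ι) (B C : ι → ℝ) (D : ι → ι → ℝ) (k c : ℝ) :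
    ∑ y ∈ s, ∑ z ∈ s, B y * C z * (k * (c / D y z)) = k * (c * ∑ y ∈ s, ∑ z ∈ s, B y * C z / D y z) := by
  rw [Finset.mul_sum, Finset.mul_sum]
  refine Finset.sum_congr rfl fun y _ => ?_
  rw [Finset.mul_sum, Finset.mul_sum]
  refine Finset.sum_congr rfl fun z _ => ?_
  ring

/-- Pulling one constant out of a weighted triple sum. [folklore] -/
theorem sum₃_pull_const {ι : Type*} (s : Finset ι) (A B C : ι → ℝ) (E : ι → ι → ι → ℝ) (c : ℝ) :
    ∑ x ∈ s, ∑ y ∈ s, ∑ z ∈ s, A x * B y * C z * (c / E x y z) =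
      c * ∑ x ∈ s, ∑ y ∈ s, ∑ z ∈ s, A x * B y * C z / E x y z := by
  rw [Finset.mul_sum]
  refine Finset.sum_congr rfl fun x _ => ?_
  rw [Finset.mul_sum]
  refine Finset.sum_congr rfl fun y _ => ?_
  rw [Finset.mul_sum]
  refine Finset.sum_congr rfl fun z _ => ?_
  ring

/-! ## §2 The oscillation ceilings force nonnegative constants -/

section Nonneg

variable (G : Type) [Group G] [TopologicalSpace G] [IsTopologicalGroup G] [CompactSpace G]
  [MeasurableSpace G] [BorelSpace G] (r : LatticeRep G)

/-- The origin has depth `1` in the unit cube `{0}⁴ = [-0, 0]⁴` (radius `0`, side `1`). [folklore] -/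
theorem one_le_depth_unitCube : 1 ≤ depth (fun _ => -((0 : ℕ) : ℤ)) (2 * 0 + 1) 0 := by
  have h := le_depth_origin (0 : Fin 4 → ℤ) 0 (t := 0) (fun j => by simp)
  have h1 : (1 : ℝ) ≤ (depth (fun _ => -((0 : ℕ) : ℤ)) (2 * 0 + 1) 0 : ℝ) := by simpa using h
  exact_mod_cast h1

/-- (E1-osc) forces `0 ≤ C₁`. [folklore] -/
theorem nonneg_of_osc₁ (a : ℝ → ℝ) (ha : Tendsto a atTop (𝓝 0)) {C₁ ℓ : ℝ} (hℓ : 0 < ℓ)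
    (hE1 : ∃ β₁ : ℝ, ∀ β : ℝ, β₁ ≤ β → ∀ (c : Fin 4 → ℤ) (b : ℕ), (b : ℝ) * a β ≤ ℓ →
      ∀ (η η' : LGConfig 4 G) (x : Fin 4 → ℤ), 1 ≤ depth c b x →
        |kerE G r β c b η (dens G r x) - kerE G r β c b η' (dens G r x)| ≤ C₁ / (depth c b x : ℝ) ^ 4) :
    0 ≤ C₁ := by
  obtain ⟨β₁, H⟩ := hE1
  obtain ⟨βa, Ha⟩ := eventually_le_of_tendsto ha hℓ
  have hfem : ((2 * 0 + 1 : ℕ) : ℝ) * a (max β₁ βa) ≤ ℓ := by simpa using Ha _ (le_max_right _ _)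
  have h := H (max β₁ βa) (le_max_left _ _) (fun _ => -((0 : ℕ) : ℤ)) (2 * 0 + 1) hfem (fun _ => 1) (fun _ => 1) 0
    (one_le_depth_unitCube)
  rw [sub_self, abs_zero] at h
  have hd : (0 : ℝ) < (depth (fun _ => -((0 : ℕ) : ℤ)) (2 * 0 + 1) 0 : ℝ) ^ 4 := by
    have : (1 : ℝ) ≤ (depth (fun _ => -((0 : ℕ) : ℤ)) (2 * 0 + 1) 0 : ℝ) := by exact_mod_cast one_le_depth_unitCube
    positivity
  exact (div_nonneg_iff.1 h).elim (fun h' => h'.1) fun h' => absurd h'.2 (not_le.2 hd)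

/-- (E2-osc) forces `0 ≤ C₂`. [folklore] -/
theorem nonneg_of_osc₂ (a : ℝ → ℝ) (ha : Tendsto a atTop (𝓝 0)) {C₂ ℓ : ℝ} (hℓ : 0 < ℓ)
    (hE2 : ∃ β₂ : ℝ, ∀ β : ℝ, β₂ ≤ β → ∀ (c : Fin 4 → ℤ) (b : ℕ), (b : ℝ) * a β ≤ ℓ →
      ∀ (η η' : LGConfig 4 G) (x y : Fin 4 → ℤ), 1 ≤ depth c b x → 1 ≤ depth c b y →
        |kerCov G r β c b η (dens G r x) (dens G r y) - kerCov G r β c b η' (dens G r x) (dens G r y)| ≤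
          C₂ / ((min (depth c b x) (depth c b y) : ℕ) : ℝ) ^ 4 / (1 + ‖siteToE (y - x)‖) ^ 4) :
    0 ≤ C₂ := by
  obtain ⟨β₂, H⟩ := hE2
  obtain ⟨βa, Ha⟩ := eventually_le_of_tendsto ha hℓ
  have hfem : ((2 * 0 + 1 : ℕ) : ℝ) * a (max β₂ βa) ≤ ℓ := by simpa using Ha _ (le_max_right _ _)
  have h := H (max β₂ βa) (le_max_left _ _) (fun _ => -((0 : ℕ) : ℤ)) (2 * 0 + 1) hfem (fun _ => 1) (fun _ => 1) 0 0
    (one_le_depth_unitCube) (one_le_depth_unitCube)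
  rw [sub_self, abs_zero] at h
  have hd : (0 : ℝ) < ((min (depth (fun _ => -((0 : ℕ) : ℤ)) (2 * 0 + 1) 0)
      (depth (fun _ => -((0 : ℕ) : ℤ)) (2 * 0 + 1) 0) : ℕ) : ℝ) ^ 4 := by
    have : (1 : ℝ) ≤ ((min (depth (fun _ => -((0 : ℕ) : ℤ)) (2 * 0 + 1) 0)
        (depth (fun _ => -((0 : ℕ) : ℤ)) (2 * 0 + 1) 0) : ℕ) : ℝ) := by
      rw [min_self]; exact_mod_cast one_le_depth_unitCube
    positivity
  have hr : (0 : ℝ) < (1 + ‖siteToE ((0 : Fin 4 → ℤ) - 0)‖) ^ 4 := by positivity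
  rw [le_div_iff₀ hr, zero_mul, le_div_iff₀ hd, zero_mul] at h
  exact h

/-- (E3-osc) forces `0 ≤ C₃`. [folklore] -/
theorem nonneg_of_osc₃ (a : ℝ → ℝ) (ha : Tendsto a atTop (𝓝 0)) {C₃ ℓ : ℝ} (hℓ : 0 < ℓ)
    (hE3 : ∃ β₃ : ℝ, ∀ β : ℝ, β₃ ≤ β → ∀ (c : Fin 4 → ℤ) (b : ℕ), (b : ℝ) * a β ≤ ℓ →
      ∀ (η η' : LGConfig 4 G) (x y z : Fin 4 → ℤ), 1 ≤ depth c b x → 1 ≤ depth c b y → 1 ≤ depth c b z →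
        |kerK3 G r β c b η x y z - kerK3 G r β c b η' x y z| ≤
          C₃ / ((min (min (depth c b x) (depth c b y)) (depth c b z) : ℕ) : ℝ) ^ 4 /
            (1 + min (min ‖siteToE (y - x)‖ ‖siteToE (z - y)‖) ‖siteToE (z - x)‖) ^ 8) :
    0 ≤ C₃ := by
  obtain ⟨β₃, H⟩ := hE3
  obtain ⟨βa, Ha⟩ := eventually_le_of_tendsto ha hℓ
  have hfem : ((2 * 0 + 1 : ℕ) : ℝ) * a (max β₃ βa) ≤ ℓ := by simpa using Ha _ (le_max_right _ _)
  have h := H (max β₃ βa) (le_max_left _ _) (fun _ => -((0 : ℕ) : ℤ)) (2 * 0 + 1) hfem (fun _ => 1) (fun _ => 1)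
    0 0 0 (one_le_depth_unitCube) (one_le_depth_unitCube) (one_le_depth_unitCube)
  rw [sub_self, abs_zero] at h
  have hd : (0 : ℝ) < ((min (min (depth (fun _ => -((0 : ℕ) : ℤ)) (2 * 0 + 1) 0)
      (depth (fun _ => -((0 : ℕ) : ℤ)) (2 * 0 + 1) 0)) (depth (fun _ => -((0 : ℕ) : ℤ)) (2 * 0 + 1) 0) : ℕ) : ℝ) ^ 4 := by
    have : (1 : ℝ) ≤ ((min (min (depth (fun _ => -((0 : ℕ) : ℤ)) (2 * 0 + 1) 0)
        (depth (fun _ => -((0 : ℕ) : ℤ)) (2 * 0 + 1) 0)) (depth (fun _ => -((0 : ℕ) : ℤ)) (2 * 0 + 1) 0) : ℕ) : ℝ) := by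
      rw [min_self, min_self]; exact_mod_cast one_le_depth_unitCube
    positivity
  have hr : (0 : ℝ) < (1 + min (min ‖siteToE ((0 : Fin 4 → ℤ) - 0)‖ ‖siteToE ((0 : Fin 4 → ℤ) - 0)‖)
      ‖siteToE ((0 : Fin 4 → ℤ) - 0)‖) ^ 8 := by positivity
  rw [le_div_iff₀ hr, zero_mul, le_div_iff₀ hd, zero_mul] at h
  exact h

end Nonneg

/-! ## §3 The card's factorised three-point margin dominates the per-triple margin -/

/-- **The per-triple margin is at most the card's factorised margin** `6 Σ h·w + 8 h³ + w₃` (in fact it equals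
`2 Σ h·w + 2 h³ + w₃`), for nonnegative constants. [folklore] -/
theorem three_margin_le_card (s : Finset (Fin 4 → ℤ)) (F G H : (Fin 4 → ℤ) → ℝ) {C₁ C₂ k : ℝ} (C₃ : ℝ)
    (hC₁ : 0 ≤ C₁) (hC₂ : 0 ≤ C₂) (hk : 0 ≤ k) :
    ∑ x ∈ s, ∑ y ∈ s, ∑ z ∈ s, |F x| * |G y| * |H z| *
        (2 * ((C₁ * k) * (C₂ * k / (1 + ‖siteToE (z - y)‖) ^ 4) +
              (C₁ * k) * (C₂ * k / (1 + ‖siteToE (z - x)‖) ^ 4) +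
              (C₁ * k) * (C₂ * k / (1 + ‖siteToE (y - x)‖) ^ 4) +
              (C₁ * k) * (C₁ * k) * (C₁ * k)) +
          C₃ * k / (1 + min (min ‖siteToE (y - x)‖ ‖siteToE (z - y)‖) ‖siteToE (z - x)‖) ^ 8) ≤
      6 * ((C₁ * k * ∑ x ∈ s, |F x|) * (C₂ * k * ∑ x ∈ s, ∑ y ∈ s, |G x| * |H y| / (1 + ‖siteToE (y - x)‖) ^ 4) +
           (C₁ * k * ∑ x ∈ s, |G x|) * (C₂ * k * ∑ x ∈ s, ∑ y ∈ s, |F x| * |H y| / (1 + ‖siteToE (y - x)‖) ^ 4) +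
           (C₁ * k * ∑ x ∈ s, |H x|) * (C₂ * k * ∑ x ∈ s, ∑ y ∈ s, |F x| * |G y| / (1 + ‖siteToE (y - x)‖) ^ 4)) +
        8 * (C₁ * k * ∑ x ∈ s, |F x|) * (C₁ * k * ∑ x ∈ s, |G x|) * (C₁ * k * ∑ x ∈ s, |H x|) +
        C₃ * k * ∑ x ∈ s, ∑ y ∈ s, ∑ z ∈ s,
          |F x| * |G y| * |H z| / (1 + min (min ‖siteToE (y - x)‖ ‖siteToE (z - y)‖) ‖siteToE (z - x)‖) ^ 8 := by
  have e := sum₃_margin_factorise s (fun x => |F x|) (fun y => |G y|) (fun z => |H z|)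
    (fun y z => (C₁ * k) * (C₂ * k / (1 + ‖siteToE (z - y)‖) ^ 4))
    (fun x z => (C₁ * k) * (C₂ * k / (1 + ‖siteToE (z - x)‖) ^ 4))
    (fun x y => (C₁ * k) * (C₂ * k / (1 + ‖siteToE (y - x)‖) ^ 4))
    (fun x y z => C₃ * k / (1 + min (min ‖siteToE (y - x)‖ ‖siteToE (z - y)‖) ‖siteToE (z - x)‖) ^ 8)
    2 ((C₁ * k) * (C₁ * k) * (C₁ * k))
  have p1 := sum₂_pull_consts s (fun y => |G y|) (fun z => |H z|) (fun y z => (1 + ‖siteToE (z - y)‖) ^ 4)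
    (C₁ * k) (C₂ * k)
  have p2 := sum₂_pull_consts s (fun x => |F x|) (fun z => |H z|) (fun x z => (1 + ‖siteToE (z - x)‖) ^ 4)
    (C₁ * k) (C₂ * k)
  have p3 := sum₂_pull_consts s (fun x => |F x|) (fun y => |G y|) (fun x y => (1 + ‖siteToE (y - x)‖) ^ 4)
    (C₁ * k) (C₂ * k)
  have p4 := sum₃_pull_const s (fun x => |F x|) (fun y => |G y|) (fun z => |H z|)
    (fun x y z => (1 + min (min ‖siteToE (y - x)‖ ‖siteToE (z - y)‖) ‖siteToE (z - x)‖) ^ 8) (C₃ * k)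
  rw [e, p1, p2, p3, p4]
  have nF : 0 ≤ ∑ x ∈ s, |F x| := Finset.sum_nonneg fun _ _ => abs_nonneg _
  have nG : 0 ≤ ∑ x ∈ s, |G x| := Finset.sum_nonneg fun _ _ => abs_nonneg _
  have nH : 0 ≤ ∑ x ∈ s, |H x| := Finset.sum_nonneg fun _ _ => abs_nonneg _
  have nGH : 0 ≤ ∑ x ∈ s, ∑ y ∈ s, |G x| * |H y| / (1 + ‖siteToE (y - x)‖) ^ 4 :=
    Finset.sum_nonneg fun _ _ => Finset.sum_nonneg fun _ _ => by positivity
  have nFH : 0 ≤ ∑ x ∈ s, ∑ y ∈ s, |F x| * |H y| / (1 + ‖siteToE (y - x)‖) ^ 4 :=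
    Finset.sum_nonneg fun _ _ => Finset.sum_nonneg fun _ _ => by positivity
  have nFG : 0 ≤ ∑ x ∈ s, ∑ y ∈ s, |F x| * |G y| / (1 + ‖siteToE (y - x)‖) ^ 4 :=
    Finset.sum_nonneg fun _ _ => Finset.sum_nonneg fun _ _ => by positivity
  have hk1 : 0 ≤ C₁ * k := mul_nonneg hC₁ hk
  have hk2 : 0 ≤ C₂ * k := mul_nonneg hC₂ hk
  have t1 : 0 ≤ (C₁ * k * ∑ x ∈ s, |F x|) * (C₂ * k * ∑ x ∈ s, ∑ y ∈ s, |G x| * |H y| / (1 + ‖siteToE (y - x)‖) ^ 4) :=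
    mul_nonneg (mul_nonneg hk1 nF) (mul_nonneg hk2 nGH)
  have t2 : 0 ≤ (C₁ * k * ∑ x ∈ s, |G x|) * (C₂ * k * ∑ x ∈ s, ∑ y ∈ s, |F x| * |H y| / (1 + ‖siteToE (y - x)‖) ^ 4) :=
    mul_nonneg (mul_nonneg hk1 nG) (mul_nonneg hk2 nFH)
  have t3 : 0 ≤ (C₁ * k * ∑ x ∈ s, |H x|) * (C₂ * k * ∑ x ∈ s, ∑ y ∈ s, |F x| * |G y| / (1 + ‖siteToE (y - x)‖) ^ 4) :=
    mul_nonneg (mul_nonneg hk1 nH) (mul_nonneg hk2 nFG)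
  have t4 : 0 ≤ (C₁ * k * ∑ x ∈ s, |F x|) * (C₁ * k * ∑ x ∈ s, |G x|) * (C₁ * k * ∑ x ∈ s, |H x|) :=
    mul_nonneg (mul_nonneg (mul_nonneg hk1 nF) (mul_nonneg hk1 nG)) (mul_nonneg hk1 nH)
  nlinarith [t1, t2, t3, t4]

/-! ## §4 The card's `RefPackage` verbatim gives `NT` -/

/-- **The crux idea's transfer target, VERBATIM, gives the crux BY NAME.**  Hypothesis = `∀ G simple, ∃ (r, a), units ∧
RefPackage G r a` of the card's `Sketch.lean` §D4 with every definition unfolded: cold-wall reference kernel of the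
origin-centred cube of radius `⌈ρ / a β⌉₊`, margins `8 h_{θv} h_v + w` (two-point) and `6 Σ h·w + 8 h³ + w₃`
(three-point, unsigned), no sign assumption on `C₁, C₂, C₃` (nonnegativity follows from the ceilings).  Conclusion:
`Summit.QuantumFields.YangMills.Theses.BalabanLadder.NT`. [folklore] -/
theorem nt_of_refPackage_card
    (h : ∀ (G : Type) [Group G] [TopologicalSpace G] [IsTopologicalGroup G] [CompactSpace G],
      IsCompactSimpleLieGroup G → letI : MeasurableSpace G := borel G; haveI : BorelSpace G := ⟨rfl⟩;
      ∃ (r : LatticeRep G) (a : ℝ → ℝ), (∀ β, 0 < a β) ∧ Tendsto a atTop (𝓝 0) ∧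
      ∃ (C₁ C₂ C₃ ℓ ρ σ κ : ℝ), 0 < σ ∧ 0 < κ ∧ 2 * (σ + κ) < ℓ ∧ σ + κ < ρ ∧
      (∃ β₁ : ℝ, ∀ β : ℝ, β₁ ≤ β → ∀ (c : Fin 4 → ℤ) (b : ℕ), (b : ℝ) * a β ≤ ℓ →
        ∀ (η η' : LGConfig 4 G) (x : Fin 4 → ℤ), 1 ≤ depth c b x →
          |kerE G r β c b η (dens G r x) - kerE G r β c b η' (dens G r x)| ≤ C₁ / (depth c b x : ℝ) ^ 4) ∧
      (∃ β₂ : ℝ, ∀ β : ℝ, β₂ ≤ β → ∀ (c : Fin 4 → ℤ) (b : ℕ), (b : ℝ) * a β ≤ ℓ →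
        ∀ (η η' : LGConfig 4 G) (x y : Fin 4 → ℤ), 1 ≤ depth c b x → 1 ≤ depth c b y →
          |kerCov G r β c b η (dens G r x) (dens G r y) - kerCov G r β c b η' (dens G r x) (dens G r y)| ≤
            C₂ / ((min (depth c b x) (depth c b y) : ℕ) : ℝ) ^ 4 / (1 + ‖siteToE (y - x)‖) ^ 4) ∧
      (∃ β₃ : ℝ, ∀ β : ℝ, β₃ ≤ β → ∀ (c : Fin 4 → ℤ) (b : ℕ), (b : ℝ) * a β ≤ ℓ →
        ∀ (η η' : LGConfig 4 G) (x y z : Fin 4 → ℤ), 1 ≤ depth c b x → 1 ≤ depth c b y → 1 ≤ depth c b z →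
          |kerK3 G r β c b η x y z - kerK3 G r β c b η' x y z| ≤
            C₃ / ((min (min (depth c b x) (depth c b y)) (depth c b z) : ℕ) : ℝ) ^ 4 /
              (1 + min (min ‖siteToE (y - x)‖ ‖siteToE (z - y)‖) ‖siteToE (z - x)‖) ^ 8) ∧
      (∃ (v : 𝓢(EuclideanSpace ℝ (Fin 4), ℝ)) (ε β₅ : ℝ),
        tsupport (v : EuclideanSpace ℝ (Fin 4) → ℝ) ⊆ {y | 0 < y 0} ∧
        tsupport (v : EuclideanSpace ℝ (Fin 4) → ℝ) ⊆ Metric.closedBall 0 σ ∧ 0 < ε ∧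
        ∀ β : ℝ, β₅ ≤ β →
          ε + 8 * (C₁ * (a β / κ) ^ 4 * ∑ x ∈ box 4 ⌈ρ / a β⌉₊, |thetaTest 4 v (a β • siteToE x)|) *
                (C₁ * (a β / κ) ^ 4 * ∑ x ∈ box 4 ⌈ρ / a β⌉₊, |v (a β • siteToE x)|) +
              C₂ * (a β / κ) ^ 4 * ∑ x ∈ box 4 ⌈ρ / a β⌉₊, ∑ y ∈ box 4 ⌈ρ / a β⌉₊,
                |thetaTest 4 v (a β • siteToE x)| * |v (a β • siteToE y)| / (1 + ‖siteToE (y - x)‖) ^ 4 ≤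
            ∑ x ∈ box 4 ⌈ρ / a β⌉₊, ∑ y ∈ box 4 ⌈ρ / a β⌉₊,
              thetaTest 4 v (a β • siteToE x) * v (a β • siteToE y) *
                (kerE G r β (fun _ => -(⌈ρ / a β⌉₊ : ℤ)) (2 * ⌈ρ / a β⌉₊ + 1) (fun _ => 1)
                    (fun U => dens G r x U * dens G r y U) -
                  kerE G r β (fun _ => -(⌈ρ / a β⌉₊ : ℤ)) (2 * ⌈ρ / a β⌉₊ + 1) (fun _ => 1) (dens G r x) *
                    kerE G r β (fun _ => -(⌈ρ / a β⌉₊ : ℤ)) (2 * ⌈ρ / a β⌉₊ + 1) (fun _ => 1) (dens G r y))) ∧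
      (∃ (f g h : 𝓢(EuclideanSpace ℝ (Fin 4), ℝ)) (ε β₅ : ℝ),
        Disjoint (tsupport (f : EuclideanSpace ℝ (Fin 4) → ℝ)) (tsupport (g : EuclideanSpace ℝ (Fin 4) → ℝ)) ∧
        Disjoint (tsupport (g : EuclideanSpace ℝ (Fin 4) → ℝ)) (tsupport (h : EuclideanSpace ℝ (Fin 4) → ℝ)) ∧
        Disjoint (tsupport (f : EuclideanSpace ℝ (Fin 4) → ℝ)) (tsupport (h : EuclideanSpace ℝ (Fin 4) → ℝ)) ∧
        tsupport (f : EuclideanSpace ℝ (Fin 4) → ℝ) ⊆ Metric.closedBall 0 σ ∧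
        tsupport (g : EuclideanSpace ℝ (Fin 4) → ℝ) ⊆ Metric.closedBall 0 σ ∧
        tsupport (h : EuclideanSpace ℝ (Fin 4) → ℝ) ⊆ Metric.closedBall 0 σ ∧ 0 < ε ∧
        ∀ β : ℝ, β₅ ≤ β →
          ε + 6 * ((C₁ * (a β / κ) ^ 4 * ∑ x ∈ box 4 ⌈ρ / a β⌉₊, |f (a β • siteToE x)|) *
                     (C₂ * (a β / κ) ^ 4 * ∑ x ∈ box 4 ⌈ρ / a β⌉₊, ∑ y ∈ box 4 ⌈ρ / a β⌉₊,
                       |g (a β • siteToE x)| * |h (a β • siteToE y)| / (1 + ‖siteToE (y - x)‖) ^ 4) +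
                   (C₁ * (a β / κ) ^ 4 * ∑ x ∈ box 4 ⌈ρ / a β⌉₊, |g (a β • siteToE x)|) *
                     (C₂ * (a β / κ) ^ 4 * ∑ x ∈ box 4 ⌈ρ / a β⌉₊, ∑ y ∈ box 4 ⌈ρ / a β⌉₊,
                       |f (a β • siteToE x)| * |h (a β • siteToE y)| / (1 + ‖siteToE (y - x)‖) ^ 4) +
                   (C₁ * (a β / κ) ^ 4 * ∑ x ∈ box 4 ⌈ρ / a β⌉₊, |h (a β • siteToE x)|) *
                     (C₂ * (a β / κ) ^ 4 * ∑ x ∈ box 4 ⌈ρ / a β⌉₊, ∑ y ∈ box 4 ⌈ρ / a β⌉₊,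
                       |f (a β • siteToE x)| * |g (a β • siteToE y)| / (1 + ‖siteToE (y - x)‖) ^ 4)) +
              8 * (C₁ * (a β / κ) ^ 4 * ∑ x ∈ box 4 ⌈ρ / a β⌉₊, |f (a β • siteToE x)|) *
                (C₁ * (a β / κ) ^ 4 * ∑ x ∈ box 4 ⌈ρ / a β⌉₊, |g (a β • siteToE x)|) *
                (C₁ * (a β / κ) ^ 4 * ∑ x ∈ box 4 ⌈ρ / a β⌉₊, |h (a β • siteToE x)|) +
              C₃ * (a β / κ) ^ 4 * ∑ x ∈ box 4 ⌈ρ / a β⌉₊, ∑ y ∈ box 4 ⌈ρ / a β⌉₊, ∑ z ∈ box 4 ⌈ρ / a β⌉₊,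
                |f (a β • siteToE x)| * |g (a β • siteToE y)| * |h (a β • siteToE z)| /
                  (1 + min (min ‖siteToE (y - x)‖ ‖siteToE (z - y)‖) ‖siteToE (z - x)‖) ^ 8 ≤
            |∑ x ∈ box 4 ⌈ρ / a β⌉₊, ∑ y ∈ box 4 ⌈ρ / a β⌉₊, ∑ z ∈ box 4 ⌈ρ / a β⌉₊,
              f (a β • siteToE x) * g (a β • siteToE y) * h (a β • siteToE z) *
                kerK3 G r β (fun _ => -(⌈ρ / a β⌉₊ : ℤ)) (2 * ⌈ρ / a β⌉₊ + 1) (fun _ => 1) x y z|)) :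
    Summit.QuantumFields.YangMills.Theses.BalabanLadder.NT := by
  intro G _ _ _ _ hG
  letI : MeasurableSpace G := borel G
  haveI : BorelSpace G := ⟨rfl⟩
  obtain ⟨r, a, ha₀, ha, C₁, C₂, C₃, ℓ, ρ, σ, κ, hσ, hκ, hℓ, hρ, hE1, hE2, hE3,
    ⟨v, ε, β₅, hvpos, hvσ, hε, HR⟩, ⟨f, g, h', ε', β₅', hfg, hgh, hfh, hfσ, hgσ, hhσ, hε', HR'⟩⟩ := h G hG
  have hℓ0 : 0 < ℓ := by linarith
  have hC₁ : 0 ≤ C₁ := nonneg_of_osc₁ G r a ha hℓ0 hE1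
  have hC₂ : 0 ≤ C₂ := nonneg_of_osc₂ G r a ha hℓ0 hE2
  have hC₃ : 0 ≤ C₃ := nonneg_of_osc₃ G r a ha hℓ0 hE3
  refine ⟨r, a, ha₀, ha, ?_, ?_⟩
  · -- clause (i): the card's margin `8hh' + w` dominates `2hh' + w`
    have HR2 : ∀ β : ℝ, β₅ ≤ β →
        ε + 2 * (C₁ * (a β / κ) ^ 4 * ∑ x ∈ box 4 ⌈ρ / a β⌉₊, |thetaTest 4 v (a β • siteToE x)|) *
              (C₁ * (a β / κ) ^ 4 * ∑ y ∈ box 4 ⌈ρ / a β⌉₊, |v (a β • siteToE y)|) +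
            C₂ * (a β / κ) ^ 4 * ∑ x ∈ box 4 ⌈ρ / a β⌉₊, ∑ y ∈ box 4 ⌈ρ / a β⌉₊,
              |thetaTest 4 v (a β • siteToE x)| * |v (a β • siteToE y)| / (1 + ‖siteToE (y - x)‖) ^ 4 ≤
          ∑ x ∈ box 4 ⌈ρ / a β⌉₊, ∑ y ∈ box 4 ⌈ρ / a β⌉₊,
            thetaTest 4 v (a β • siteToE x) * v (a β • siteToE y) *
              kerCov G r β (fun _ => -(⌈ρ / a β⌉₊ : ℤ)) (2 * ⌈ρ / a β⌉₊ + 1) ((fun _ => fun _ => (1 : G)) β)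
                (dens G r x) (dens G r y) := by
      intro β hβ
      have hc := HR β hβ
      have hk : 0 ≤ (a β / κ) ^ 4 := pow_nonneg (div_nonneg (ha₀ β).le hκ.le) 4
      have n1 : 0 ≤ C₁ * (a β / κ) ^ 4 * ∑ x ∈ box 4 ⌈ρ / a β⌉₊, |thetaTest 4 v (a β • siteToE x)| :=
        mul_nonneg (mul_nonneg hC₁ hk) (Finset.sum_nonneg fun _ _ => abs_nonneg _)
      have n2 : 0 ≤ C₁ * (a β / κ) ^ 4 * ∑ y ∈ box 4 ⌈ρ / a β⌉₊, |v (a β • siteToE y)| :=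
        mul_nonneg (mul_nonneg hC₁ hk) (Finset.sum_nonneg fun _ _ => abs_nonneg _)
      have n12 := mul_nonneg n1 n2
      simp only [kerCov]
      linarith
    obtain ⟨β₆, H2⟩ := q2_floor_of_reference G r a ha₀ ha hC₁ hC₂ hσ hκ hℓ hρ (fun _ => fun _ => (1 : G)) hE1 hE2
      v ε β₅ hvσ HR2
    exact ⟨v, ε, β₆, σ + κ + 1, hvpos, hε, H2⟩
  · -- clause (ii): the card's factorised margin dominates the per-triple margin
    have HR3 : ∀ β : ℝ, β₅' ≤ β →
        ε' + ∑ x ∈ box 4 ⌈ρ / a β⌉₊, ∑ y ∈ box 4 ⌈ρ / a β⌉₊, ∑ z ∈ box 4 ⌈ρ / a β⌉₊,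
            |f (a β • siteToE x)| * |g (a β • siteToE y)| * |h' (a β • siteToE z)| *
              (2 * ((C₁ * (a β / κ) ^ 4) * (C₂ * (a β / κ) ^ 4 / (1 + ‖siteToE (z - y)‖) ^ 4) +
                    (C₁ * (a β / κ) ^ 4) * (C₂ * (a β / κ) ^ 4 / (1 + ‖siteToE (z - x)‖) ^ 4) +
                    (C₁ * (a β / κ) ^ 4) * (C₂ * (a β / κ) ^ 4 / (1 + ‖siteToE (y - x)‖) ^ 4) +
                    (C₁ * (a β / κ) ^ 4) * (C₁ * (a β / κ) ^ 4) * (C₁ * (a β / κ) ^ 4)) +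
                C₃ * (a β / κ) ^ 4 /
                  (1 + min (min ‖siteToE (y - x)‖ ‖siteToE (z - y)‖) ‖siteToE (z - x)‖) ^ 8) ≤
          |∑ x ∈ box 4 ⌈ρ / a β⌉₊, ∑ y ∈ box 4 ⌈ρ / a β⌉₊, ∑ z ∈ box 4 ⌈ρ / a β⌉₊,
            f (a β • siteToE x) * g (a β • siteToE y) * h' (a β • siteToE z) *
              kerK3 G r β (fun _ => -(⌈ρ / a β⌉₊ : ℤ)) (2 * ⌈ρ / a β⌉₊ + 1) ((fun _ => fun _ => (1 : G)) β) x y z| := by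
      intro β hβ
      have hc := HR' β hβ
      have hk : 0 ≤ (a β / κ) ^ 4 := pow_nonneg (div_nonneg (ha₀ β).le hκ.le) 4
      have dom := three_margin_le_card (box 4 ⌈ρ / a β⌉₊) (fun x => f (a β • siteToE x)) (fun y => g (a β • siteToE y))
        (fun z => h' (a β • siteToE z)) C₃ hC₁ hC₂ hk
      linarith
    obtain ⟨β₇, H3⟩ := q3_floor_of_reference G r a ha₀ ha hC₁ hC₂ hC₃ hσ hκ hℓ hρ (fun _ => fun _ => (1 : G))
      hE1 hE2 hE3 f g h' ε' β₅' hfσ hgσ hhσ HR3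
    exact ⟨f, g, h', ε', β₇, σ + κ + 1, hfg, hgh, hfh, hε', H3⟩

end Summit.QuantumFields.YangMills.Cruxes.NT.Reference

end
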